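import Literature.NumberTheory.EllipticCurves.Kobayashi2003.SignedSelmer
import Literature.NumberTheory.EllipticCurves.Rank1Residual.Predicates
import HarnessLib.Audit.Tags
import HarnessLib

/-!
# The SIGNED (±) subgroups at `2` along the cyclotomic `ℤ₂`-tower of `ℚ₂` — span, meet and trace laws for good supersingular `a₂ ∈ {0, ±2}`
# (cell `bsd-f1-sign2`, search question «what is the signed / ± object at 2?»; -imc g20 D-imc-60 `Sketch61.lean` a3f61a5ac8bdbe79 + `Sketch62.lean` e8b98cffdbb0a0b0
# = MEMO-imc §10.100 / add1 / add2, bundle `HOME/MEMO-imc-data/dimc60/`; REF1-AUDIT §228 (Sketch61; REF1 audit of Sketch62 PENDING at filing); typer -ty g20)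

STATUS (v2, typer -ty g20; v1 = p737686 filed 2026-08-29T18:22Z).  v1 FILED Sketch61's four REF1 §228-audited rows over the `ℚ_[2]` carrier — C2 `SignedSpanAtTwoOfTraceZero`,
C3 `SignedMeetAtTwo`, C4 `DoubleTraceDivisibleAtTwo`, C4a `TraceTwoLayersDownModTwoAtTwo` (Sketch61 VERBATIM; REF1 §230: 4/4 IDENTICAL).  Posted AFTER v1 was filed: -imc
§10.100-add3 (18:21Z), REF2 v57 ERRATUM (18:27Z), REF1 §228b/§230.  Consequences recorded here (docstring-only change; the four declarations are byte-identical to v1):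
(i) the load-bearing input «(B2)@2» is ALREADY TYPED — `F1Sign2.HondaSystemAtTwoExists` (`F1Sign2/HondaSystemAtTwo.lean`, D-imc-47, -ty g12), descended to `ℚ_{2,n}` by
`F1Sign2.DeltaTraceSurjectiveAtTwo`; v1's sentence «to be typed here when -imc sketches it» is WITHDRAWN below.  (ii) C2 `SignedSpanAtTwoOfTraceZero` and the `a₂ = 0` half
of C3 `SignedMeetAtTwo` RESTATE, in lattice language over `ℚ_[2]`, the cell's earlier `F1Sign2.SignedDecompositionAtTwo` ((C3-47): `v.adicCompletion` carrier, `∃ P₁ P₂`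
decomposition + meet clause) — a DEDUP MISS by the typer (the name-level search was clean; a content-level check against `HondaSystemAtTwo.lean` was not made; -imc's
add3 (a)(ii) «NOT to be filed again» arrived one minute before the filing and was read after it).  The tree is append-only, so both stay as `ℚ_[2]`-lattice DUPLICATES;
`SignedDecompositionAtTwo` is the STATEMENT OF RECORD, and the house-style kernel derives the lattice form from it
(`SignedSpanDefect.Kernel.span_eq_layer_of_signedDecomposition`, `…meet_eq_layer_zero_of_rows`), so nothing rests on the duplicates.  (iii) The Sketch62 rows C1′/C5/C6
that v1 announced for an append to THIS file were re-typed by -imc in the cell's house style (`Sketch63.lean` 9c3690a8639523cd, `v.adicCompletion ℚ` carriers, namespace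
`…F1Sign2.SignedSpanDefect`; REF1 §228b) and are FILED as the sibling `F1Sign2/SignedSpanDefectAtTwo.lean` (p738666: C1′ `SignedSpanIndexFloorLawAtTwo`, C6
`SignedTopDefectAtTwo`, C5 `SignedDefectInjectsAtTwo`, C3± `SignedMeetAtTwoOfTraceNeZero`, PLAIN) with kernel `SignedSpanDefectAtTwoKernel.lean` (p738809: C5 ∧ C6 ⟹ C1′
PROVED) — nothing is appended here, and the C1′/C5/C6 paragraphs below describe the sibling's rows.  (iv) C3 (all three types), C4, C4a below remain the rows OF RECORD for
their content, in the `ℚ_[2]`-carrier form (REF1 §230: Sketch63's `v.adicCompletion` restatements of C4/C4a «rightly dropped» from the sibling as duplicates of these; C3's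
`a₂ = ±2` half is ALSO filed house-style as C3±).  Carrier note (REF1 §228b item 5): `ℚ_[2]` vs `v.adicCompletion ℚ` at `v ∋ 2` is no change of content; both conventions
occur in the tree; no transport lemma is filed.

STATEMENTS ONLY (plain `def … : Prop` over tree declarations; nothing asserted, no `sorry`, no instance, no named fact; the kernel-decided sanity
theorems and REF1's BC7 certificates live in the sibling `SignedSubgroupsAtTwoKernel.lean`).  BSD is not proved by this; 23715 is not closed by this.

OBJECTS (all TREE carriers, `Literature/NumberTheory/EllipticCurves/Kobayashi2003/SignedSelmer.lean`): `k_n = ℚ_{2,n}` the `n`-th layer of the cyclotomic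
`ℤ₂`-extension `κ` of `ℚ` completed at `2` (`[k_n : ℚ₂] = 2ⁿ`); `E(k_n)` = `localLayerPoints κ ℚ_[2] W n` (fixed points of `Gal(ℚ̄₂/k_n)`, l.179/389); Kobayashi's
`E^±_n = E^{±}(k_n)` = `signedLocalPoints κ ℚ_[2] W (±1) n` (Def. 1.1 VERBATIM on the `ℤ_p`-tower: trace conditions at all layers `m < n` of parity `(−1)^m = ±1`,
l.322/397) [cite: Kobayashi2003, Def. 1.1]; the traces `Tr_{n/m}` = `localTrace κ ℚ_[2] W m n` (sum over coset representatives, l.208/393); `Rank1Residual.GoodSS W 2` =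
good reduction ∧ `2 ∣ a₂` (`Literature/…/Rank1Residual/Predicates.lean` l.110) — at `2` exactly supersingular, and by Hasse `a₂ ∈ {0, 2, −2}`.

ROWS (rank = -imc's; REF1-AUDIT §228 verdicts, `HOME/REF1-AUDIT-v1.md`, probe `REF1-data/b228/Probe228.lean` c3ba1643cb05fc5f rc 0, BC7 a–g sorry-free):
* C1′ `SignedSpanIndexFloorLawAtTwo` (FILED in the sibling `SignedSpanDefectAtTwo.lean`, Sketch63 house style, PLAIN) — `a₂ = ±2`: `[E(k_n) : E^+_n + E^-_n] = 2^(Σ_{m ≤ n} ⌊2^m/15⌋)` (log₂-index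
  0,0,0,1,3,7,15,32,66,134 for n = 1..10).  It SUPERSEDES Sketch61's C1 `SignedSpanIndexLawAtTwo` (`= 2^(2^(n−3) − 1)`, extrapolated from n ≤ 7), which is
  REFUTED-MISSTATED at `n = 8` by its own registered cheapest falsifier (kit j334501, engine L `i_n.py` 78e89c00584ad87a, 1400 bits: log₂-index **32** for `a₂ = 2`,
  = the value -imc PRE-REGISTERED from the derivation (INBOX 2026-08-29T18:02:31Z, before the row existed) and ≠ C1's 31; INBOX 18:06:24Z) — C1 is NOT typed here
  (CANDIDATES.md records it KILLED / refuted-misstated; the kernel sibling decides `2^(n−3) − 1 = Σ_{m≤n}⌊2^m/15⌋` for n ≤ 7 and `31 ≠ 32` at n = 8).  C1′ comes with a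
  PEN-AND-PAPER DERIVATION (MEMO-imc §10.100-add1) from the integral Honda presentation (B2) `ℓÊ(k_m) = ℤ₂[G]ℓ(d_m) + ℤ₂[G]ℓ(d_{m−1})` and the trace relations
  `Tr_{m+1/m} d_{m+1} = a₂ d_m − d_{m−1}`: in the isotypic line `V_j ≅ ℚ₂(ζ_{2^j})`, `(d_k)_j = b_{k−j}(d_j)_j` with `b_0 = 1, b_1 = a₂/2, 2b_{k+1} = a₂ b_k − b_{k−1}`; for
  `a₂ = ±2`, `b_k = 0 ⟺ k ≡ 3 (mod 4)`, whence the per-layer defect `δ_m = v_π(N_B(ζ_{2^m})) = Σ_{1 ≤ j < m, j ≡ m+1 (4)} 2^{j−1} = ⌊2^m/15⌋` and `i_n = Σ_{m ≤ n} δ_m`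
  (covolume bookkeeping checked numerically n ≤ 6); for `a₂ = 0` all `b_odd = 0`, so `δ_m = 0` (= C2 by the same argument).  (B2) at `p = 2` is numerically verified
  (n ≤ 7, three engines) but NOT a theorem of the tree — the one load-bearing hypothesis of C1′, C2, C4, C4a (REF1 §228 item 5).  R228b (REF1): the index depends on `W`
  ONLY THROUGH `a₂` — `E(k_n) = E(ℚ₂) + Ê(𝔪_n)` (Hensel; residue field `𝔽₂`) and `E(ℚ₂) ≤ E^+ ∩ E^-` (tree `localLayerPointsOfEmb_zero_le_signedLocalPointsOfEmb`) give
  `[E(k_n) : E^+ + E^-] = [Ê(𝔪_n) : Ê^+ + Ê^-]` for the Honda formal group of type `T² − a₂T + 2`: a statement about TWO formal groups (`a₂ = 2, −2`) along one tower.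
  R228d: C1′ ⟺ the per-layer defect law `δ_n = ⌊2ⁿ/15⌋` (falsifiable layer by layer).  BC7-e: at `n ≤ 1` the rows hold BY DEFINITION for every type (`E^ε_0 = E(k_0)`;
  the minus condition is empty below layer 1, so `E^-_1 = E(k_1)`) — content from `n = 2`.
* C2 `SignedSpanAtTwoOfTraceZero` (PLAIN; DUPLICATE of `F1Sign2.SignedDecompositionAtTwo`, see STATUS (ii)) — `a₂ = 0`: `E^+_n + E^-_n = E(k_n)`, Kobayashi Prop. 8.12 (ii) READ AT 2 on the `ℤ₂`-tower
  [cite: Kobayashi2003, Prop. 8.12]; content = (B2) at 2 (variant-of-print).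
* C3 `SignedMeetAtTwo` (PLAIN; THEOREM IN SUBSTANCE, R228c/R228c′; `a₂ = 0` half = `SignedDecompositionAtTwo`'s meet clause) — all three types: `E^+_n ∩ E^-_n = E(ℚ₂)`; = Kobayashi 8.12 (i)'s argument verbatim (isotypic reading
  `E^± ⊗ ℚ = V_0 ⊕ ⊕_{j even/odd} V_j`, meet `V_0`; `E(ℚ₂)` is `2`-saturated in `E(k_n)` because `E(k_n)[2] = 0` — `e(k_n/ℚ₂) = 2ⁿ` is prime to `3` and `#Ẽ(𝔽₂) = 3 − a₂` is
  odd); the containment `⊇` is the tree lemma `localLayerPointsOfEmb_zero_le_signedLocalPointsOfEmb`.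
* C5 `SignedDefectInjectsAtTwo` (FILED in the sibling; REF1 §228b R228e: THEOREM IN SUBSTANCE given `E(ℚ_{2,n})[2] = 0` only — no (B2)) — the defect modules INJECT along the tower:
  `(E^+_n + E^-_n) ∩ E(k_m) = E^+_m + E^-_m` for `m ≤ n`, all three types (census n = 6, m = 0..5, `a₂ = ±2`: `log₂[Λ_m : Λ_m ∩ S_6] = i_m`); C6 `SignedTopDefectAtTwo`
  (FILED in the sibling; theorem-candidate modulo (B2) + `E[2] = 0`, REF1 §228b; = the PER-LAYER form R228d asked by REF1 §228 item 6) — `a₂ = ±2`: `[E(k_{n+1}) : E^+_{n+1} + E^-_{n+1} + E(k_n)]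
  = 2^⌊2^{n+1}/15⌋` (1,1,1,2,4,16,256,2^17 for n+1 = 1..8; δ = 0,0,0,1,2,4 from points n+1 ≤ 6, `i_7 − i_6 = 8`, `i_8 − i_7 = 17` from kit j334501).  **C5 ∧ C6 ⟹ C1′**
  (-imc: «by induction on n») is PROVED in the sibling's kernel (`SignedSpanDefect.Kernel.floorLaw_of_injects_of_topDefect`: `[E_{n+1} : S_{n+1}] = [E_{n+1} : S_{n+1} + E_n]·[E_n : S_{n+1} ∩ E_n]`,
  second isomorphism theorem + C5; base `E^ε_0 = E(k_0)`), so C1′ reduces to the two layer-local rows.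
* C4 `DoubleTraceDivisibleAtTwo` (PLAIN; theorem-candidate modulo (B2)) — `Tr_{n+2/n} E(k_{n+2}) ⊆ 2·E(k_{n+2})`; C4a `TraceTwoLayersDownModTwoAtTwo` (PLAIN; theorem-candidate
  modulo (B2)) — `Tr_{n+2/n+1} E(k_{n+2}) ⊆ E(k_n) + 2·E(k_{n+2})` (sharp: not `E(k_{n−1})`).  REF1 re-derived both from (B2): `Tr_{n/n−2} d_n = (a₂² − 2)d_{n−2} − a₂ d_{n−3} ∈ 2Ê`,
  `Tr_{n/n−2} d_{n−1} = 2·Tr d_{n−1}`; `Tr d_n ≡ −d_{n−2} (mod 2)`.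
BINDER AUDIT (REF1 §228 item 2, kernel-checked in Probe228; ported to the kernel sibling): `H.relIndex K = [K : H ⊓ K]` so `(E⁺ ⊔ E⁻).relIndex E(k_n)` IS `[E(k_n) : E⁺ + E⁻]`
(the reversed order is identically `1`); `localTrace m n = Tr_{n/m}` lands in layer `m`; ℕ-truncation/ℕ-division give exponent `0` for `n ≤ 3`; `κ.IsCyclotomic` is redundant
over `ℚ` (unique `ℤ₂`-extension) but keeps the Kobayashi carriers aligned; a `∀ κ` cannot be discharged vacuously (`ZpExtension`, `localPoints` carry data).  CHOICE OF TOWER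
(REF1 §228 4(iv)): the tree's Def. 1.1 lives on the cyclotomic `ℤ_p`-TOWER (conditions at `0 ≤ m < n`) = the `Δ`-invariants of Kobayashi's `μ_{p^{n+1}}`-tower definition for
odd `p`; at `p = 2` there is no `Δ`-splitting (`ℚ₂(μ_{2^{n+2}}) = k_n(i)`), so «Kobayashi READ AT 2» is the `ℤ₂`-tower reading, made consistently by carriers, engines and rows;
the `μ`-tower variant is a DIFFERENT statement, not typed.

DATA = BC5 WITNESS (MEMO-imc §10.100; numbers not adjectives): engine P = `engine/k60.gp` 4de43f09056134cb (curve points of prescribed formal level + formal logarithm of the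
minimal model; 19a1, 35a1 (`a₂ = 0`), 67a1 (`a₂ = 2`), 11a1 (`a₂ = −2`); layers n = 3 (kit j334335), n = 4 (kit j334336); analysis `an/an60.py` 19714dbcb498fbc8) and engine
L = `an/i_n.py` 78e89c00584ad87a / `an/tr_n.py` (pure log model with Sprung's closed-form Honda logarithms, n ≤ 7, `a₂ ∈ {0, ±2}`; n = 8 kit j334501); P and L agree on every
shared cell (n = 3, 4: ranks, indices, mod-2 shadows).  `[E(k_n) : E^+ + E^-]`: `= 1` for `a₂ = 0`, n ≤ 8; log₂ = 0,0,0,1,3,7,15,32 for `a₂ = ±2` (n = 1..8, BOTH signs at n = 8 per §10.100-add2; `Q₇/2Q₇ ≅ 𝔽₂[x]/x⁸ ⊕ 𝔽₂[x]/x⁴`), quotients `ℤ/2`, `(ℤ/2)³`, `(ℤ/2)⁵ ⊕ ℤ/4` (n = 4, 5, 6), Smith form `(ℤ/2)⁹ ⊕ (ℤ/4)³` at n = 7; `E^+ ∩ E^- = E(ℚ₂)` (rank 1) all types n ≤ 7; ranks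
`rank E^± = 1 + Σ_{j ≤ n, j even/odd} φ(2^j)` (sum `2ⁿ + 1`, REF1 re-derived); `Tr_{n/n−2}E(k_n) ⊆ 2E(k_n)` and `Tr_{n/n−1}E(k_n) ⊆ E(k_{n−2}) + 2E(k_n)` with image
dimensions 0,1,1,3,5,11 mod 2 (n = 1..6), all types.  -imc's pre-registered scorecard P60-0..9 (INBOX 17:56:12Z): P60-2 top step = the bound of
[cite: KuriharaOtsuki2006, Prop. 1.4] ATTAINED; P60-8 `W_δ = κ(ℤ₂[G]d_{n−1})` exactly.

PRINT / PLACEMENT.  In print: [cite: Kobayashi2003, Def. 1.1, Prop. 8.12] (`p` ODD, `a_p = 0`: `E^+ + E^- = E`, `E^+ ∩ E^- = E(k_{−1})`); [cite: Sprung2013, p. 7] «for the case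
`a_p = 0`, Kobayashi was able to decompose `E(𝔪_n)` into `E^±(𝔪_n)` … this seems to be very hard in the case `a_p ≠ 0` … we bypass this decomposition»
[corpus:paper:arxiv-1106.1936 p0007:L39]; [cite: KuriharaOtsuki2006, Prop. 1.4] (`p = 2`, `a₂ ≠ 0`: `#(F(k_{n−1})/N F(k_n)) ≥ 2^{q_n}`, `q_n = Σ (−1)^k 2^{n−1−k}`)
[corpus:paper:doi-10-4310-pamq-2006-v2-n2-a8 p0007:L8] and p. 557 «one can define ± Selmer groups as in Kobayashi and study them by the same method as for `p > 2`» (no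
proof); barrier `Literature/Barriers/BirchSwinnertonDyer/IwasawaTheoryAtTwo.lean` (`SignedIwasawaTheoryAtTwoBarrier`: every ALGEBRAIC signed source assumes `p` odd) — these
rows are exactly the local layer-by-layer statements a ±-theory at `(2, a₂ = ±2)` must start from, and C1′ says the naive ± span FAILS there by a computable `2`-power
(`⌊2ⁿ/15⌋` new defect per layer), while the meet (C3) and the `a₂ = 0` span (C2) behave as for odd `p`.  REF1 presearch (corpus fts + vec, galaxy `--star all`): C1/C1′ →
none.  REF2-PLACEMENT-v57 §3 (af4e22a98e1c31e7; `REF2-data/check_l-v57.py` a6669ef2a86e4dfc): **(B2)@2** `Ê(ℚ_{2,m}) = ℤ₂[G]d_m + ℤ₂[G]d_{m−1}` with the three-term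
Honda recursion, all three types, is NOT IN PRINT AS STATED for `ℚ_{2,n}` — [cite: Pollack2005, Thm. 3.1] is `p` odd on `ℚ_{n,p}` (points = Perrin-Riou 1990; proof = Kobayashi
8.11/8.12 with Honda type `t² − a_pt + p`) [corpus:paper:arxiv-math_0407393 p0005 L6–58]; [cite: Sprung2012, Thm. 2.2] is `p = 2`, any `a₂`, but over `k_n = ℚ₂(ζ_{2^{n+2}})` with the
two-element bottom (2′) [corpus:paper:doi-10-1016-j-jnt-2011-11-003 p0004 L75–76, p0005 L27–34] — the passage to the cyclic layer `ℚ_{2,n} = k_n^{⟨−1⟩}` is NOT automatic; [cite: KuriharaOtsuki2006, Prop. 1.4]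
gives only the norm-index bound (answer to -imc add1 (c): two-generation is NOT stated there); R57d: -imc's `(d₀, d_{−1} ∈ V₀)` bottom normalisation matches Sprung's (2′), not Pollack's
bottom relation (singular at `(2, 2)`).  So (B2)@2 is a port-of-print THEOREM-CANDIDATE and THE ONE LOAD-BEARING INPUT of C1′–C6 (numerically index `2⁰` at n ≤ 8, three engines);
REF2's recommendation (1) «make it the named crux `HondaTwoGenerationAtTwo`» was WITHDRAWN (ERRATUM 18:27Z; -imc add3): (B2)@2 IS the tree's
`F1Sign2.HondaSystemAtTwoExists` (D-imc-47; [cite: Sprung2012, Thm. 2.2, Lemma 2.3] in `ℤ₂`-tower form, descended by `F1Sign2.DeltaTraceSurjectiveAtTwo`).  ROWS: C1 DEAD; C1′/C5/C6 NOT IN PRINT (statement or phenomenon; nearest [cite: Sprung2013, p. 7],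
[cite: Sprung2012, Open Problem 7.22], [cite: KuriharaOtsuki2006, p. 1]) = corollary-of-(B2)@2, **beyond print: YES-small** (an exact law for the failure of Kobayashi's decomposition at
`(2, ±2)`), two independent pen-and-paper derivations (-imc add1; REF2 §3.1 with the new mod-2 identity R57a `ℓ_k = t_{k+2}` verified k = 2..7) + data n ≤ 8; C2 = Kobayashi 8.12 (ii)
at 2 GIVEN (B2)@2 (corollary-of-print/port; beyond print no); C3 ELEMENTARY in the frame (needs `Ê(K_n)[2] = 0`, [cite: Sprung2012, Lemma 2.3]); C4/C4a corollary of (B2)@2, with a sharper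
EXACT form `Tr_{n+2/n}Ê(K_{n+2}) = 2Ê(K_n)` recommended to -imc (not typed here).  R57c (lens offer to -imc): the period-4 «quarter-signed» trace groups `E^{[r]}_n` span EXACTLY under
(B2)@2 at `a₂ = ±2` — not typed (no sketch).  PARTITION: none moved.  Beyond-print theorem: no (conjecture-grade rows with derivations modulo an unported print input).  BSD is not proved by this; nothing
here closes 23715.

PORT (typer -ty g20): bodies of C2, C3, C4, C4a = Sketch61 l.66–108 VERBATIM = REF1 Probe228 byte-for-byte (REF1 §230: 4/4 IDENTICAL); C1′, C5, C6 (and C3±) = the SIBLING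
`SignedSpanDefectAtTwo.lean` (Sketch63 VERBATIM, PLAIN — REF1 §230: no `@[conjecture]` needed, the load-bearing input carries the status); layer 5 from points (§10.100-add2, kit j334400: `i₅ = 0,0,3,3`,
`W_δ = κD₄`, (B2) index `2⁰`) folded as census; namespace `…F1Sign2.SignedSubgroupsAtTwo` (the sketch's, re-rooted under `Rank1Residual` like every F1Sign2 file);
sketch docstrings kept, typer riders marked «RIDER»; prose source lists rendered as cite tags.  bears_on: stmt-BirchSwinnertonDyer-23715 (cell question; no route consumes
these rows yet).
-/

namespace Summit.BirchSwinnertonDyer.Rank1Residual.F1Sign2.SignedSubgroupsAtTwo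

open Literature.NumberTheory.EllipticCurves Literature.NumberTheory.EllipticCurves.Kobayashi2003
  ZpExtension WeierstrassCurve

/-- **C2 · `SignedSpanAtTwoOfTraceZero` · theorem-candidate (rank 3; Kobayashi Prop. 8.12 (ii) READ AT 2).**
`a₂ = 0` ⇒ `E^+_n + E^-_n = E(k_n)` for every layer `n` of the cyclotomic `ℤ₂`-extension.  Census: n ≤ 7 (engine L),
n = 3, 4 on 19a1, 35a1 (engine P).  In print only for p odd (Kobayashi 2003 Prop. 8.12; «can define ± Selmer groups as in
Kobayashi and study them by the same method as for p > 2», Kurihara–Otsuki 2006 p. 557, no proof); the tree has the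
plus Honda system at 2 (`PlusLayer.plusHondaSystemTwo_padic`).  Why it might fail: only if Def. 1.1's FULL-group traces
see 2-power torsion at 2 — excluded (`E(k_n)[2] = 0`: the 2-division field of a curve supersingular at 2 has degree
divisible by 3).
(RIDER, typer -ty g20: PLAIN — theorem-candidate (REF1-AUDIT §228: SURVIVES A1–A6 + BC7; content = the integral Honda presentation (B2) at `2`; Kobayashi
Prop. 8.12 (ii) READ AT 2 on the cyclotomic `ℤ₂`-tower = variant-of-print); = the `a₂ = 0` case of C1′'s derivation (all `b_odd = 0 ⟹ δ_m = 0`, MEMO-imc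
§10.100-add1); BC7-e: at `n ≤ 1` it holds by definition for every type (kernel: `minus_one_eq_layer`); census `a₂ = 0`: index `1` for n ≤ 8 (engine L incl. kit
j334501), n = 3, 4 on 19a1/35a1 (engine P).  [cite: Kobayashi2003, Prop. 8.12] [cite: KuriharaOtsuki2006, p. 557]  REF2-PLACEMENT-v57 §3.2: = Kobayashi 8.12 (ii) at `p = 2` GIVEN (B2)@2 (`a₂ = 0 ⇒ b_odd = 0 ⇒ ℤ₂[G]d_k ⊆ E^{par(k)}`; Kobayashi's proof verbatim, `p` odd, `ℚ_p(ζ_{p^{n+1}})`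
[cite: Kobayashi2003, Prop. 8.12]); at `p = 2` only the sentence of [cite: KuriharaOtsuki2006, p. 1] (no proof); grade corollary-of-print / port of [cite: Pollack2005, Thm. 3.1] and
[cite: Sprung2012, Thm. 2.2]; beyond print: no.)
(v2 DEDUP NOTE, typer: this row RESTATES the first clause of `F1Sign2.SignedDecompositionAtTwo` (D-imc-47) in lattice form over `ℚ_[2]` (`AddSubgroup.mem_sup`);
STATEMENT OF RECORD = `SignedDecompositionAtTwo`; the house-style kernel proves the lattice form from it (`SignedSpanDefect.Kernel.span_eq_layer_of_signedDecomposition`).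
Kept only because the tree is append-only; do not cite this row, cite (C3-47).) -/
def SignedSpanAtTwoOfTraceZero : Prop :=
  ∀ (W : WeierstrassCurve ℚ) [W.IsElliptic] [W.IsGloballyMinimal],
    Rank1Residual.GoodSS W 2 → W.frobeniusTrace 2 = 0 →
    ∀ (κ : ZpExtension ℚ 2), κ.IsCyclotomic → ∀ n : ℕ,
      signedLocalPoints κ ℚ_[2] W 1 n ⊔ signedLocalPoints κ ℚ_[2] W (-1) n = localLayerPoints κ ℚ_[2] W n

/-- **C3 · `SignedMeetAtTwo` · theorem-candidate (rank 4; Kobayashi Prop. 8.12 (i) READ AT 2, ALL THREE TYPES).**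
`E^+_n ∩ E^-_n = E(ℚ₂)` (`= E(k_0)`) for every supersingular type `a₂ ∈ {0, ±2}` and every `n`.  Census: rank
`(E^+ ∩ E^-) = 1` and the mod-2 shadow `κ(E^+) ∩ κ(E^-) ⊇ κ(E(ℚ₂))` with equality iff a₂ = 0 or n ≤ 3 (n ≤ 7).
Mechanism (why easier than it looks): `ℓ : Ê(k_n) ⊗ ℚ ≅ k_n ≅ ℚ₂[G]` and Def. 1.1 cuts out the isotypic pieces
`V_0 ⊕ ⊕_{j even} V_j` resp. `V_0 ⊕ ⊕_{j odd} V_j`, whose meet is `V_0 = ` the `G`-invariants; the odd torsion of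
`E(k_n)` is `E(ℚ₂)`-rational (k_n/ℚ₂ totally ramified).  Why it might fail: none known; it is the containment
`⊇` that is the tree lemma `localLayerPointsOfEmb_zero_le_signedLocalPointsOfEmb`.
(RIDER, typer -ty g20: PLAIN — THEOREM IN SUBSTANCE (REF1-AUDIT §228 R228c): `E⁺ ∩ E⁻ ⊗ ℚ = V_0 = E(ℚ₂) ⊗ ℚ` by the isotypic reading, and `E(ℚ₂)` is
`2`-saturated in `E(k_n)` (`2P ∈ E(ℚ₂) ⟹ σP − P ∈ E(k_n)[2] = 0`; `E(k_n)[2] = 0` because `e(k_n/ℚ₂) = 2ⁿ` is prime to `3` and `#Ẽ(𝔽₂) = 3 − a₂` is odd), so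
`E⁺ ∩ E⁻ = E(ℚ₂)` for all three types and all `n` — exactly Kobayashi's 8.12 (i) argument; the only input is the logarithm `Ê(𝔪_n) ⊗ ℚ ≅ k_n ≅ ℚ₂[G]` (normal basis),
NO (B2).  BC7-d: `n = 0` by definition (kernel).  In print in substance [cite: Kobayashi2003, Prop. 8.12] (`p` odd, `a_p = 0`); beyond-print theorem: no.
REF2-PLACEMENT-v57 §3.2: ELEMENTARY in the isotypic frame (`E⁺ ∩ E⁻ = Λ ∩ V₀ = Λ^G = Ê(ℚ₂)`); content = «Def. 1.1 ⟺ isotypic cut-out», which needs `Ê(K_n)[2] = 0`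
([cite: Sprung2012, Lemma 2.3]: the `2`-torsion of a height-2 formal group lives in a totally ramified extension of degree `3`); print states the overlap «up to a constant overlap
`E(𝔪_{−1})`» for `a_p = 0`, `p` odd [cite: Sprung2013, p. 7]; grade: elementary / in print in substance; beyond print: no.)
(v2, typer: the `a₂ = 0` half of this row = `F1Sign2.SignedDecompositionAtTwo`'s meet clause (statement of record for `a₂ = 0`); the `a₂ = ±2` half is ALSO filed
house-style as `SignedSpanDefect.SignedMeetAtTwoOfTraceNeZero` (p738666, `v.adicCompletion` carrier); together, all types: `SignedSpanDefect.Kernel.meet_eq_layer_zero_of_rows`.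
REF1 §228b R228c′: THEOREM IN SUBSTANCE modulo `E(ℚ_{2,n})[2] = 0` ONLY — downward induction on all trace conditions, no isotypic model, no (B2); engine M 18/18.) -/
def SignedMeetAtTwo : Prop :=
  ∀ (W : WeierstrassCurve ℚ) [W.IsElliptic] [W.IsGloballyMinimal],
    Rank1Residual.GoodSS W 2 →
    ∀ (κ : ZpExtension ℚ 2), κ.IsCyclotomic → ∀ n : ℕ,
      signedLocalPoints κ ℚ_[2] W 1 n ⊓ signedLocalPoints κ ℚ_[2] W (-1) n = localLayerPoints κ ℚ_[2] W 0

/-- **C4 · `DoubleTraceDivisibleAtTwo` · theorem-candidate (rank 5).**  The double trace is divisible by 2: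
`Tr_{n+2/n} E(k_{n+2}) ⊆ 2·E(k_{n+2})`, all three types.  Census: the mod-2 shadow of `Tr_{n/n−2}E(k_n)` is ZERO for
n = 2..6 (engine L, all types) and n = 3, 4 (engine P, 4 curves).  Mechanism: with the Honda presentation
`Ê(k_n) = ℤ₂[G]d_n + ℤ₂[G]d_{n−1}` (§10.90 (B2), n ≤ 7) and `Tr_{n/n−1} d_n = a₂ d_{n−1} − d_{n−2}`:
`Tr_{n/n−2} d_n = (a₂² − 2) d_{n−2} − a₂ d_{n−3} ∈ 2Ê` because `a₂` is even, and `Tr_{n/n−2} d_{n−1} = 2·Tr_{n−1/n−2} d_{n−1}`.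
Why it might fail: it leans on generation (B2) at every n (census n ≤ 7, words-proof (B0)⇒(B2) in §10.90 not kernel-checked).
(RIDER, typer -ty g20: PLAIN — theorem-candidate MODULO (B2) (REF1-AUDIT §228 items 5 and 8: the two displayed trace lines re-derived by REF1; (B2) is the
one load-bearing hypothesis).  BC7-f/g (kernel, verbatim): `localTrace κ ℚ_[2] W n (n+2) P ∈ E(k_n)` for `P ∈ E(k_{n+2})` — the trace goes DOWN two layers as
`Tr_{n+2/n}` must; on `P ∈ E(k_n)` itself it is multiplication by the index `[Gal(ℚ̄₂/k_n) : Gal(ℚ̄₂/k_{n+2})]` (tree: a divisor of `2^(n+2)`, not kernel-available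
as `= 4`) — no vacuity, no junk proof.  Not in print as a statement.  REF2-PLACEMENT-v57 §3.2: corollary of (B2)@2 + the Honda recursion with `a₂` even — and SHARPER IN EXACT FORM (REF2's recommendation (4) to -imc, NOT typed here: no sketch, no
REF1 audit): `Tr_{n+2/n}Ê(K_{n+2}) = 2Ê(K_n)` for all three types (the images `2(d_n − s d_{n−1})`, `2(2s d_n − d_{n−1})` generate `2Λ_n`; consistent with -imc's trace indices at
`n = 5` and add2 (b)); adjacent classical result: universal norms of one-dimensional formal groups in the cyclotomic `Γ`-extension vanish [cite: Hazewinkel1974NormMapsI, §2.4] and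
the lower bound [cite: KuriharaOtsuki2006, Prop. 1.4]; grade: corollary; not stated in print.)
(v2, typer: ROW OF RECORD for this content, `ℚ_[2]` carrier — Sketch63's `v.adicCompletion` restatement was dropped from the sibling `SignedSpanDefectAtTwo.lean` as a
duplicate, REF1 §230 «rightly dropped»; REF1 §228b: SURVIVES modulo (B2) = `F1Sign2.HondaSystemAtTwoExists`, engine M 18/18, n ≤ 7, all three types.) -/
def DoubleTraceDivisibleAtTwo : Prop :=
  ∀ (W : WeierstrassCurve ℚ) [W.IsElliptic] [W.IsGloballyMinimal],
    Rank1Residual.GoodSS W 2 →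
    ∀ (κ : ZpExtension ℚ 2), κ.IsCyclotomic → ∀ n : ℕ,
      ∀ P ∈ localLayerPoints κ ℚ_[2] W (n + 2),
        ∃ R ∈ localLayerPoints κ ℚ_[2] W (n + 2), localTrace κ ℚ_[2] W n (n + 2) P = 2 • R

/-- **C4a · `TraceTwoLayersDownModTwoAtTwo` · theorem-candidate (rank 6).**  ONE trace lands TWO layers down modulo 2:
`Tr_{n+2/n+1} E(k_{n+2}) ⊆ E(k_n) + 2·E(k_{n+2})`, all three types (sharp: `E(k_n)` cannot be replaced by `E(k_{n−1})`;
the image has 𝔽₂-dimension 1,1,3,5,11 at n+2 = 2..6 and equals the mod-2 shadow of the Honda module `ℤ₂[G]d_n` at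
n+2 = 3, 4 — engine P, P60-3′).  Census: engine L n+2 = 2..6 all types; engine P n+2 = 3, 4 on 4 curves.
Why it might fail: as C4 (generation (B2) beyond n = 7).
(RIDER, typer -ty g20: PLAIN — theorem-candidate MODULO (B2), as C4 (REF1-AUDIT §228: `Tr d_n ≡ −d_{n−2} (mod 2)` re-derived); `(n+1) (n+2)` = `Tr_{n+2/n+1}` ✓
(BC7-f).  Not in print as a statement.  REF2-PLACEMENT-v57 §3.2: corollary of (B2)@2; «C4a sharper with `R ∈ Ê(K_{n+1})`»; not stated in print.)
(v2, typer: ROW OF RECORD, `ℚ_[2]` carrier (Sketch63's restatement dropped from the sibling, REF1 §230); REF1 §228b: SURVIVES modulo (B2); SHARPNESS confirmed by engine M —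
replacing `E(k_n)` by `E(k_{n−1})` fails with 2-adic index `2^(2^(n−3))`, n = 3..7.) -/
def TraceTwoLayersDownModTwoAtTwo : Prop :=
  ∀ (W : WeierstrassCurve ℚ) [W.IsElliptic] [W.IsGloballyMinimal],
    Rank1Residual.GoodSS W 2 →
    ∀ (κ : ZpExtension ℚ 2), κ.IsCyclotomic → ∀ n : ℕ,
      ∀ P ∈ localLayerPoints κ ℚ_[2] W (n + 2),
        ∃ Q ∈ localLayerPoints κ ℚ_[2] W n, ∃ R ∈ localLayerPoints κ ℚ_[2] W (n + 2),
          localTrace κ ℚ_[2] W (n + 1) (n + 2) P = Q + 2 • R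

end Summit.BirchSwinnertonDyer.Rank1Residual.F1Sign2.SignedSubgroupsAtTwo
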